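import Summits.QuantumFields.YangMills.Theorems.BalabanUVNodesN05SubBKnitZdLan
import Literature.MathematicalPhysics.QuantumFieldTheory.Balaban1983to89.B8Thm8SurvivingZd3Map

/-!
# BalabanUVNodes ∕ N05 ([B8], `Dag.B8_main`) — THE SubB KNIT WITH THEOREM 8's SURVIVING MEMBER `t8` SUPPLIED AT THE LAW MEMBERS:
# `BalabanUVNodesN05SubBKnitZdLan.exists_c₁_b8LeafRS_subB_cut_zdLan_of_knit_lettersRDUB` (p482401 §2) with its hypothesis
# `t8 : Thm8SurvivingAt 1 λ.B₁ λ.B₂ (famB8OfRecordSubB θ λ.β λ.len)` DISCHARGED by `B8Thm8SurvivingZd3Map.thm8SurvivingAt_zd3_map_lan` (n05-c g4's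
# t8S chain, re-keyed) at the index map `j ↦ j.1.1` of `IdxB8SubB θ` — so that the printed member Theorem 8 (p. 101) is no longer displayed, and in
# its place stand Theorem 8's PRIMITIVE inputs at the law members: the five SOURCED sockets (Prop. 5 ∃∕! at the source-indexed gauge predicate,
# [4] Thm 3.3 WITH SOURCE, Prop. 3 WITH SOURCE)

Track A of `YM-PLAN.md` (cell `pub-ymgap`, HUMAN RULING D-0062), node **N05** = [Balaban1985RegularSpaces] Lemma 1, Thm 2, Prop 3, Thm 4, Props 5–7,
Thm 8; R134 seat `pub-ymgap-dag-n05-d` (g5), 2026-08-27, taking the knit face offered by seat `pub-ymgap-dag-n05-c` g4 (INBOX 03:29Z 08-27) on its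
`B8Thm8SurvivingZd3.thm8SurvivingAt_zd3_univ_lan` (p491941).  Sequel of `BalabanUVNodesN05SubBKnitZdLan` v1.1 (p482401): that knit displays N05's two
remaining [B8]-OWN printed members `p7` (Prop. 7 p. 100) and `t8` (Thm 8 p. 101, surviving form at γ = 1 with the record's constants `λ.B₁, λ.B₂`).

WHAT IS PROVED (composition BY NAME; no estimate; no new definition):
* ★ **`exists_c₁_b8LeafRS_subB_cut_zdLan_of_knit_lettersRDUB_t8src`** — p482401 §2 VERBATIM (same conclusion: `∃ c₁ > 0, B8LeafRS …` over `IdxB8SubB θ`,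
  Prop. 5's carriers `zdLan ∘ ι`, the law-cut cube slot, `λ.toAxial`) EXCEPT that the hypothesis `t8` is GONE, replaced by Theorem 8's inputs AT THE LAW
  MEMBERS `i : ZdIdx θ.D θ.L` with `i.Ω 0 = ℤᵈ` and `IdxB8LawsB θ.L i` (= the index `IdxB8SubB θ` of the leaf): Prop. 5's radius `cu`, thresholds `cP`,
  `cP3`, print's source size `γ₈ ≥ 1` (p. 101 «e.g. γ = 1»; larger γ only strengthens the sockets), the b9 source constant `γ′ ≥ 0`, the enlarged
  constant `B₈ ≥ B₀` with `5dLB₀ + 2γ′B₀ ≤ 5dLB₈`; the source-indexed gauge predicate `LanF` with its top-level clause `hLanF` (= (1.146)); and the five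
  sourced sockets `SP5base`, `SP5`, `SH59src`, `SP5u`, `SP3src` of `B8Thm8SurvivingZd3` keyed there.  THE LAYER: Theorem 8's surviving form is NOT
  monotone in `B₁` (the competitors of its uniqueness clause carry `C136 B₁`), so the face PINS the record's Thm-2∕8 constants to the values the chain
  produces, `λ.B₁ = 5dL·B₈·(1 + 11d²)`, `λ.B₂ = 5dL·λ.B₀β·(1 + 11d²)` (`hB₁eq`, `hB₂eq`) — consistent with the knit's own `5dLB₀ ≤ λ.B₁` and `2 ≤ λ.B₁`,
  which become consequences and are no longer hypotheses.  Proof: `thm8SurvivingAt_zd3_map_lan` at `ι := fun j : IdxB8SubB θ => j.1.1`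
  (`famB8OfRecordSubB θ β len j = zdGF3 θ.𝔸 θ.L β len j.1.1` definitionally), `B8Thm8Surviving.thm8SurvivingAt_anti` (γ ↦ 1), then p482401 §2 by name.
AFTER THIS FILE the N05 SubB knit displays EXACTLY ONE printed member of [Balaban1985RegularSpaces] as a hypothesis — `p7` (Prop. 7 p. 100; species word,
n05-c g4's kernel evidence `B8Prop7GlevZd3` ∕ `BalabanUVNodesN05Prop7UnitAxial`) — everything else displayed being SOCKETS: [4]'s letters (four families)
and b9 sockets (N06 lineage), and the five sourced sockets above (providers: Prop. 5 with source = the JOIN twins with the `H′f` particular solution;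
[4] Thm 3.3 with source; Prop. 3 with source — located, XL, not in the tree).
HONEST FRAMING: kernel bookkeeping by name; the sourced sockets, [4]'s letters and the b9 sockets are HYPOTHESES; `p7` is a HYPOTHESIS = N05's own printed
member NOT discharged; count-neutral; **N05 NOT discharged**; Bałaban AS PRINTED with locators; one finite 𝕋⁴ programme at fixed ε; nothing continuum ∕
ℝ⁴ ∕ OS ∕ mass-gap ∕ Clay.  No `sorry`, no new definition.  Unit `pub-ymgap-dag-n05-d` (g5), 2026-08-27.
[cite: Balaban1985RegularSpaces, Thm 8 (1.146) p.101 (supplied modulo sourced sockets), Lemma 1 p.79, Thm 2 p.83, Prop. 3 p.87, Thm 4 p.88, Prop. 5 (1.107)–(1.109) p.94, Prop. 6 (1.131)–(1.138) pp.98–99 (the knit); Prop. 7 p.100 (named hypothesis); Balaban1985BackgroundPropagators, Thm 3.1 p.397, Thm 3.3 p.398, (3.25) p.394 (letters, b9 socket and sourced b9 socket, hypotheses)]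

SCOPE NOTE (v-scope, 2026-08-27, seat pub-ymgap-dag-n05-c g11; director-ym LINE №196; NO statement change).  Every hypothesis of this file that is a
(1.59)-type socket read over the typed constraint-bond class `B8CubeMemberZd.cubeLamB` ∕ `B8IdxB8LawsB.towerBonds` (`SockH59`-, `SockB9P3`-shaped
binders: Theorem 4's ∕ Proposition 3's frame) is UNINHABITED at every nested member with `k ≥ 1` as soon as the socket is owed at the flat background
`U₀ = 1` (interior shell gauge modes — kernel certificates `B8Ineq159FlatShellModeVacuity` p572834, `B8SockB9P3ShellModeVacuityUniv` p576185; root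
cause: the class has no crossing bond, `B8Ineq159FlatCubeMemberPrinted.towerBonds_inner_of_printTower`).  The theorems below stay TRUE (PASS-AS-DECLARED) and
are VACUOUS wherever such a socket is among their hypotheses; the repaired class is `B8Ineq159FlatCubeMemberPrinted.cubeLamBP` (print's (1.31)∕[B6] (2.3)),
over which the consumers are being re-typed (edition γ).  Sockets over the SITE tower `cubeLamS` only (`SockHFP`, `SockP5u…`, the REAL families, the
𝒢-bound) are NOT affected.

-/

noncomputable section

namespace Summit.QuantumFields.YangMills.BalabanUVNodes.N05SubBKnitZdLanT8

open Literature.MathematicalPhysics.QuantumFieldTheory.Balaban1983to89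
open Literature.MathematicalPhysics.QuantumFieldTheory.Balaban1983to89.Node00
open Literature.MathematicalPhysics.QuantumFieldTheory.Balaban1983to89.B8IdxB8LawsB (towerBonds IdxB8LawsB IdxB8SubB famB8OfRecordSubB)
open Literature.MathematicalPhysics.QuantumFieldTheory.Balaban1983to89.B8LeafModelZd (ZdIdx)
open Literature.MathematicalPhysics.QuantumFieldTheory.Balaban1983to89.B8LeafModelZd3 (SockB9P3 zdGF3)
open Literature.MathematicalPhysics.QuantumFieldTheory.Balaban1983to89.B8SockLettersRD (SockLettersRD)
open Literature.MathematicalPhysics.QuantumFieldTheory.Balaban1983to89.B8LeafKnitRS (B8LeafRS)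
open Literature.MathematicalPhysics.QuantumFieldTheory.Balaban1983to89.B8Lemma1NonAbelian (blockPairNA mulCfg)
open Literature.MathematicalPhysics.QuantumFieldTheory.Balaban1983to89.B8Eq131CubesAdmissible (cubeFam)
open Literature.MathematicalPhysics.QuantumFieldTheory.Balaban1983to89.B8CubeMemberZd (cubeLamS cubeLamB)
open Literature.MathematicalPhysics.QuantumFieldTheory.Balaban1983to89.B8Prop5LandauDataZd (ZdLanIdx zdLan)
open Literature.MathematicalPhysics.QuantumFieldTheory.Balaban1983to89.B8Thm8SurvivingZd3Map (thm8SurvivingAt_zd3_map_lan)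
open Summit.QuantumFields.YangMills.BalabanUVNodes.N05SubBKnitZdLan (exists_c₁_b8LeafRS_subB_cut_zdLan_of_knit_lettersRDUB)
open MatrixLog B7Prop1Explicit B7Prop2Explicit B7Prop1Local B7Eq92Concrete
open B8Ineq130 (tlo thi)
open B8Ineq132 (InAk covDerivFwd)
open B7Eq78Linearization (zdBlocking QprimeIter)
open B8Eq119TwistedAxial (bgT Restr129 InAx)
open B8Eq140Level (SideTouches)
open B8Eq138LandauZd (covLap QT IsLandau146W InR138)
open B8Eq1117Concrete (XSpace)
open B8Prop5ContractionKLevel (Bd2)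
open B8LambdaSpaceKLevel (wt)
open B8Eq184Proof (gaugeExp cfgExp)
open B8Eq146AExpansion (iEta)
open B7Prop4GeneralLevels (linCovIter)
open B8Eq155JBound (Jcur wsup)
open B8ScaledSupNorm (bondNorm msup)

section KnitT8

/-- ★ **THE SURVIVING [B8] LEAF OVER `IdxB8SubB θ` — BOTH HALVES OF PROPOSITION 5 SUPPLIED AT `zdLan`, PROPOSITION 6 AT THE LAW-CUT CUBE SLOT, AND THEOREM 8
(SURVIVING) SUPPLIED AT THE LAW MEMBERS FROM THE SOURCED SOCKETS.**  `BalabanUVNodesN05SubBKnitZdLan.exists_c₁_b8LeafRS_subB_cut_zdLan_of_knit_lettersRDUB`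
(p482401 §2) VERBATIM — record residual `λ : ResidB8 θ` with its constant conditions, [4]'s letters at the law members (`SLet`, guarded `SLetUB`), at their
cubes (`SLetC`), at the Prop-5 members `ι : J → ZdLanIdx` (`SLetL`, `SLetLU`) with the three member laws, the b9 sockets `SB9all`, `SB9C`, the printed member
`p7` — EXCEPT: the printed member **`t8` IS NO LONGER A HYPOTHESIS**.  In its place: `cu cP cP3 > 0`, `γ₈ ≥ 1`, `γ′ ≥ 0`, `B₈ ≥ λ.inp.B₀` with
`5dLB₀ + 2γ′B₀ ≤ 5dLB₈`, the layer equations `λ.B₁ = 5dL·B₈·(1 + 11d²)`, `λ.B₂ = 5dL·λ.B₀β·(1 + 11d²)`, the source-indexed gauge predicate `LanF` with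
(1.146) at the top level (`hLanF`), and the five SOURCED sockets `SP5base SP5 SH59src SP5u SP3src` AT THE LAW MEMBERS (`i.Ω 0 = ℤᵈ ∧ IdxB8LawsB θ.L i`).
Conclusion unchanged: `∃ c₁ > 0, B8LeafRS …` (the surviving [B8] leaf over `IdxB8SubB θ`, Prop. 5's carriers `zdLan ∘ ι`, the law-cut cube slot).  NOT a
discharge of N05 (`p7`, the letters, the b9 sockets and the sourced sockets are hypotheses).
[cite: Balaban1985RegularSpaces, Thm 8 (1.146) p.101, Thm 2 p.83 («There exist constants B₁, B₂(β₀), c₁»), Prop. 5 (1.107)–(1.109) p.94, Prop. 6 pp.98–99, Lemma 1 p.79, Prop. 3 p.87, Thm 4 p.88; Prop. 7 p.100 (named hypothesis); Balaban1985BackgroundPropagators, Thm 3.1 p.397, Thm 3.3 p.398, (3.25) p.394 (hypotheses)] -/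
theorem exists_c₁_b8LeafRS_subB_cut_zdLan_of_knit_lettersRDUB_t8src {θ : Stage3Params} (lam : ResidB8 θ) (hD : 2 ≤ θ.D)
    (hB₁' : lam.B₁' = 5 * (θ.D : ℝ) * θ.L * lam.inp.B₀)
    {cB9 B₀'H B₂' BG BR cL : ℝ} (hB : 2 ≤ 5 * (θ.D : ℝ) * θ.L * lam.inp.B₀) (hB₀β : 0 < lam.B₀β) (hC₂ : 2097152 * ((θ.D : ℝ) + 1) ^ 2 ≤ lam.C₂)
    (hcB9 : 0 < cB9) (hB₀'H : 0 < B₀'H) (hB₂' : 0 ≤ B₂') (hBG : 0 ≤ BG) (hBR : 0 ≤ BR) (hcL : 0 < cL)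
    (hfree : 3 * (2 * (θ.D : ℝ) * (θ.L : ℝ) ^ 2) * BG * BR ≤ lam.inp.B₀')
    -- the free-constant condition of the Prop.-5 provider (at half `B₀′`)
    (hfree2 : 3 * (2 * (θ.D : ℝ) * (θ.L : ℝ) ^ 2) * BG * BR ≤ lam.inp.B₀' / 2)
    -- [4]'s letters at the LAW members: existence side (laws on print's domains) and uniqueness side
    (SLet : ∀ i : ZdIdx θ.D θ.L, IdxB8LawsB θ.L i → SockLettersRD (𝔸 := θ.𝔸) θ.L BG BR B₀'H B₂' cL i.η i.k i.Ω i.Λs)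
    (SLetUB : ∀ i : ZdIdx θ.D θ.L, IdxB8LawsB θ.L i → ∀ α₀ : ℝ, 0 < α₀ → α₀ ≤ cL → ∀ U₀ : Site θ.D → Fin θ.D → θ.𝔸ˣ, (∀ x κ, U₀ x κ ∈ unitaryUnits θ.𝔸) →
      InAk θ.L i.k i.η α₀ i.Ω U₀ →
      ∃ (g Δ : (Site θ.D → θ.𝔸) →ₗ[ℂ] (Site θ.D → θ.𝔸)) (q : (Site θ.D → θ.𝔸) →ₗ[ℂ] (ℕ → Site θ.D → θ.𝔸))
        (qs : (ℕ → Site θ.D → θ.𝔸) →ₗ[ℂ] (Site θ.D → θ.𝔸)) (Aw c : (ℕ → Site θ.D → θ.𝔸) →ₗ[ℂ] (ℕ → Site θ.D → θ.𝔸))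
        (H' : XSpace θ.D i.k θ.𝔸 →ₗ[ℂ] (Site θ.D → θ.𝔸)),
        (∀ x : Site θ.D → θ.𝔸, (∃ C : ℝ, ∀ y, ‖x y‖ ≤ C) → g (Δ x + qs (Aw (q x))) = x) ∧ (∀ φ, qs (c (q (g (g (qs φ))))) = qs φ) ∧
        (∀ (f : Site θ.D → θ.𝔸), ∀ x ∈ i.Ω 0, Δ f x = covLap i.η U₀ ((i.Ω 0).indicator f) x) ∧
        (∀ (μ : ℕ → Site θ.D → θ.𝔸), ∀ x ∈ i.Ω 0, qs μ x = QT θ.L i.k (i.Λs i.k) U₀ μ x) ∧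
        (∀ (f : Site θ.D → θ.𝔸) (n : ℕ), n ≤ i.k → ∀ y ∈ i.Λs i.k n, q f n y = QprimeIter (zdBlocking θ.D θ.L) (bgT θ.L U₀) n f y) ∧
        (∀ (f : Site θ.D → θ.𝔸) (n : ℕ) (y : Site θ.D), ¬ (n ≤ i.k ∧ y ∈ i.Λs i.k n) → q f n y = 0) ∧
        (∀ (X : XSpace θ.D i.k θ.𝔸) (x : Site θ.D), ‖H' X x‖ ≤ B₀'H * ‖X‖) ∧
        (∀ n, n ≤ i.k → ∀ (X : XSpace θ.D i.k θ.𝔸), ∀ p ∈ {b : Site θ.D × Fin θ.D | SideTouches (i.Ω n) b.1 b.2},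
          wt θ.L i.η n * ‖covDerivFwd i.η U₀ p.2 (H' X) p.1‖ ≤ B₀'H * ‖X‖) ∧
        (∀ X : XSpace θ.D i.k θ.𝔸, Bd2 θ.L i.η i.k i.Ω (covLap i.η U₀ (H' X)) (B₂' * ‖X‖)) ∧
        (∀ (Y : XSpace θ.D i.k θ.𝔸) (n : ℕ) (hn : n ≤ i.k) (y : Site θ.D), y ∈ i.Λs i.k n →
          QprimeIter (zdBlocking θ.D θ.L) (bgT θ.L U₀) n (H' Y) y = Y (⟨n, Nat.lt_succ_of_le hn⟩, y)) ∧
        (∀ (f : Site θ.D → θ.𝔸) (r : ℝ), 0 ≤ r → Bd2 θ.L i.η i.k i.Ω f r →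
          (∀ x, ‖g f x‖ ≤ BG * r) ∧ ∀ n, n ≤ i.k → ∀ p ∈ {b : Site θ.D × Fin θ.D | SideTouches (i.Ω n) b.1 b.2},
            wt θ.L i.η n * ‖covDerivFwd i.η U₀ p.2 (g f) p.1‖ ≤ BG * r) ∧
        (∀ (f : Site θ.D → θ.𝔸) (r : ℝ), 0 ≤ r → Bd2 θ.L i.η i.k i.Ω f r → Bd2 θ.L i.η i.k i.Ω (f - g (qs (c (q (g f))))) (BR * r)))
    (SB9all : ∀ i : ZdIdx θ.D θ.L, IdxB8LawsB θ.L i → ∀ m, m ≤ i.k →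
      SockB9P3 (𝔸 := θ.𝔸) θ.L lam.inp.B₀ lam.B₀β cB9 lam.β lam.len i.η m i.Ω i.Λs i.Λb)
    -- AT EVERY CUBE of every law member: the existence letters and the b9 socket at the CUBE geometry (finite-Ω₀ members)
    (SLetC : ∀ i : ZdIdx θ.D θ.L, IdxB8LawsB θ.L i → ∀ c : CubeB8 θ.D θ.L i.k i.Ω,
      SockLettersRD (𝔸 := θ.𝔸) θ.L BG BR B₀'H B₂' cL i.η c.k (cubeFam false θ.L c.a c.M c.ρ c.k) (cubeLamS θ.L c.a c.M c.ρ c.k))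
    (SB9C : ∀ i : ZdIdx θ.D θ.L, IdxB8LawsB θ.L i → ∀ c : CubeB8 θ.D θ.L i.k i.Ω, ∀ m, m ≤ c.k →
      SockB9P3 (𝔸 := θ.𝔸) θ.L lam.inp.B₀ lam.B₀β cB9 lam.β lam.len i.η m (cubeFam false θ.L c.a c.M c.ρ c.k) (cubeLamS θ.L c.a c.M c.ρ c.k)
        (cubeLamB θ.L c.a c.M c.ρ c.k))
    -- PROPOSITION 5's INDEX READ AS OBJECTS: `zdLan` members obeying the member laws, with [4]'s letters at each (RD currency)
    {J : Type} (ι : J → ZdLanIdx θ.D θ.𝔸)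
    (hΩ0L : ∀ a : J, (ι a).Ω 0 = Set.univ) (hΩL : ∀ a : J, ∀ j, (ι a).Ω (j + 1) ⊆ (ι a).Ω j)
    (htowerL : ∀ a : J, ∀ j, j ≤ (ι a).k → ∀ y ∈ (ι a).Λ j, ∀ x, InBox (tlo θ.L y j) (thi θ.L y j) x → x ∈ (ι a).Ω j)
    (SLetL : ∀ a : J, ∀ α₀ : ℝ, 0 < α₀ → α₀ ≤ cL → InAk θ.L (ι a).k (ι a).η α₀ (ι a).Ω (ι a).U₀ →
      ∃ (g Δ : (Site θ.D → θ.𝔸) →ₗ[ℂ] (Site θ.D → θ.𝔸)) (q : (Site θ.D → θ.𝔸) →ₗ[ℂ] (ℕ → Site θ.D → θ.𝔸))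
        (qs : (ℕ → Site θ.D → θ.𝔸) →ₗ[ℂ] (Site θ.D → θ.𝔸)) (Aw c : (ℕ → Site θ.D → θ.𝔸) →ₗ[ℂ] (ℕ → Site θ.D → θ.𝔸))
        (H' : XSpace θ.D (ι a).k θ.𝔸 →ₗ[ℂ] (Site θ.D → θ.𝔸)),
        (∀ x, ∀ y ∈ (ι a).Ω 0, (Δ (g x) + qs (Aw (q (g x)))) y = x y) ∧ (∀ f, q (g (g (qs (c (q f))))) = q f) ∧
        (∀ (f : Site θ.D → θ.𝔸), ∀ x ∈ (ι a).Ω 0, Δ f x = covLap (ι a).η (ι a).U₀ (((ι a).Ω 0).indicator f) x) ∧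
        (∀ (μ : ℕ → Site θ.D → θ.𝔸), ∀ x ∈ (ι a).Ω 0, qs μ x = QT θ.L (ι a).k (ι a).Λ (ι a).U₀ μ x) ∧
        (∀ (f : Site θ.D → θ.𝔸) (j : ℕ), j ≤ (ι a).k → ∀ y ∈ (ι a).Λ j, q f j y = QprimeIter (zdBlocking θ.D θ.L) (bgT θ.L (ι a).U₀) j f y) ∧
        (∀ (X : XSpace θ.D (ι a).k θ.𝔸) (x : Site θ.D), ‖H' X x‖ ≤ B₀'H * ‖X‖) ∧
        (∀ j, j ≤ (ι a).k → ∀ (X : XSpace θ.D (ι a).k θ.𝔸), ∀ p ∈ {b : Site θ.D × Fin θ.D | SideTouches ((ι a).Ω j) b.1 b.2},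
          wt θ.L (ι a).η j * ‖covDerivFwd (ι a).η (ι a).U₀ p.2 (H' X) p.1‖ ≤ B₀'H * ‖X‖) ∧
        (∀ X : XSpace θ.D (ι a).k θ.𝔸, Bd2 θ.L (ι a).η (ι a).k (ι a).Ω (covLap (ι a).η (ι a).U₀ (H' X)) (B₂' * ‖X‖)) ∧
        (∀ (X : XSpace θ.D (ι a).k θ.𝔸) (x : Site θ.D), x ∉ (ι a).Ω 0 → H' X x = 0) ∧
        (∀ X Y : XSpace θ.D (ι a).k θ.𝔸, (∀ p, Y p = -star (X p)) → ∀ x, H' Y x = -star (H' X x)) ∧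
        (∀ (Y : XSpace θ.D (ι a).k θ.𝔸) (j : ℕ) (hj : j ≤ (ι a).k) (y : Site θ.D), y ∈ (ι a).Λ j →
          QprimeIter (zdBlocking θ.D θ.L) (bgT θ.L (ι a).U₀) j (H' Y) y = Y (⟨j, Nat.lt_succ_of_le hj⟩, y)) ∧
        (∀ (f : Site θ.D → θ.𝔸) (r : ℝ), 0 ≤ r → Bd2 θ.L (ι a).η (ι a).k (ι a).Ω f r →
          (∀ x, ‖g f x‖ ≤ BG * r) ∧ ∀ j, j ≤ (ι a).k → ∀ p ∈ {b : Site θ.D × Fin θ.D | SideTouches ((ι a).Ω j) b.1 b.2},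
            wt θ.L (ι a).η j * ‖covDerivFwd (ι a).η (ι a).U₀ p.2 (g f) p.1‖ ≤ BG * r) ∧
        (∀ (f : Site θ.D → θ.𝔸) (x : Site θ.D), x ∉ (ι a).Ω 0 → g f x = 0) ∧
        (∀ f : Site θ.D → θ.𝔸, (∀ j, j ≤ (ι a).k → ∀ x ∈ (ι a).Ω j, IsSelfAdjoint (f x)) → ∀ x, IsSelfAdjoint (g f x)) ∧
        (∀ (f : Site θ.D → θ.𝔸) (r : ℝ), 0 ≤ r → Bd2 θ.L (ι a).η (ι a).k (ι a).Ω f r →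
          Bd2 θ.L (ι a).η (ι a).k (ι a).Ω (f - g (qs (c (q (g f))))) (BR * r)) ∧
        (∀ f : Site θ.D → θ.𝔸, (∀ j, j ≤ (ι a).k → ∀ x ∈ (ι a).Ω j, IsSelfAdjoint (f x)) →
          ∀ j, j ≤ (ι a).k → ∀ x ∈ (ι a).Ω j, IsSelfAdjoint ((f - g (qs (c (q (g f))))) x)))
    -- [4]'s UNIQUENESS letters at the Prop-5 members (left-inverse law of G′ on bounded functions), for Prop. 5's uniqueness clause there
    (SLetLU : ∀ a : J, ∀ α₀ : ℝ, 0 < α₀ → α₀ ≤ cL → InAk θ.L (ι a).k (ι a).η α₀ (ι a).Ω (ι a).U₀ →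
      ∃ (g Δ : (Site θ.D → θ.𝔸) →ₗ[ℂ] (Site θ.D → θ.𝔸)) (q : (Site θ.D → θ.𝔸) →ₗ[ℂ] (ℕ → Site θ.D → θ.𝔸)) (qs : (ℕ → Site θ.D → θ.𝔸) →ₗ[ℂ] (Site θ.D → θ.𝔸))
        (Aw c : (ℕ → Site θ.D → θ.𝔸) →ₗ[ℂ] (ℕ → Site θ.D → θ.𝔸)) (H' : XSpace θ.D (ι a).k θ.𝔸 →ₗ[ℂ] (Site θ.D → θ.𝔸)),
        (∀ x : Site θ.D → θ.𝔸, (∃ C : ℝ, ∀ y, ‖x y‖ ≤ C) → g (Δ x + qs (Aw (q x))) = x) ∧ (∀ φ, qs (c (q (g (g (qs φ))))) = qs φ) ∧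
        (∀ (f : Site θ.D → θ.𝔸), ∀ x ∈ (ι a).Ω 0, Δ f x = covLap (ι a).η (ι a).U₀ (((ι a).Ω 0).indicator f) x) ∧
        (∀ (μ : ℕ → Site θ.D → θ.𝔸), ∀ x ∈ (ι a).Ω 0, qs μ x = QT θ.L (ι a).k (ι a).Λ (ι a).U₀ μ x) ∧
        (∀ (f : Site θ.D → θ.𝔸) (n : ℕ), n ≤ (ι a).k → ∀ y ∈ (ι a).Λ n, q f n y = QprimeIter (zdBlocking θ.D θ.L) (bgT θ.L (ι a).U₀) n f y) ∧
        (∀ (f : Site θ.D → θ.𝔸) (n : ℕ) (y : Site θ.D), ¬ (n ≤ (ι a).k ∧ y ∈ (ι a).Λ n) → q f n y = 0) ∧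
        (∀ (X : XSpace θ.D (ι a).k θ.𝔸) (x : Site θ.D), ‖H' X x‖ ≤ B₀'H * ‖X‖) ∧
        (∀ n, n ≤ (ι a).k → ∀ (X : XSpace θ.D (ι a).k θ.𝔸), ∀ p ∈ {b : Site θ.D × Fin θ.D | SideTouches ((ι a).Ω n) b.1 b.2},
          wt θ.L (ι a).η n * ‖covDerivFwd (ι a).η (ι a).U₀ p.2 (H' X) p.1‖ ≤ B₀'H * ‖X‖) ∧
        (∀ X : XSpace θ.D (ι a).k θ.𝔸, Bd2 θ.L (ι a).η (ι a).k (ι a).Ω (covLap (ι a).η (ι a).U₀ (H' X)) (B₂' * ‖X‖)) ∧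
        (∀ (Y : XSpace θ.D (ι a).k θ.𝔸) (n : ℕ) (hn : n ≤ (ι a).k) (y : Site θ.D), y ∈ (ι a).Λ n →
          QprimeIter (zdBlocking θ.D θ.L) (bgT θ.L (ι a).U₀) n (H' Y) y = Y (⟨n, Nat.lt_succ_of_le hn⟩, y)) ∧
        (∀ (f : Site θ.D → θ.𝔸) (r : ℝ), 0 ≤ r → Bd2 θ.L (ι a).η (ι a).k (ι a).Ω f r →
          (∀ x, ‖g f x‖ ≤ BG * r) ∧ ∀ n, n ≤ (ι a).k → ∀ p ∈ {b : Site θ.D × Fin θ.D | SideTouches ((ι a).Ω n) b.1 b.2},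
            wt θ.L (ι a).η n * ‖covDerivFwd (ι a).η (ι a).U₀ p.2 (g f) p.1‖ ≤ BG * r) ∧
        (∀ (f : Site θ.D → θ.𝔸) (r : ℝ), 0 ≤ r → Bd2 θ.L (ι a).η (ι a).k (ι a).Ω f r →
          Bd2 θ.L (ι a).η (ι a).k (ι a).Ω (f - g (qs (c (q (g f))))) (BR * r)))
    -- the remaining printed member (Prop. 7 p. 100; species word)
    (p7 : B8SectGH.Prop7PrintedR (fun j : IdxB8SubB θ => famB8OfRecordSubB θ lam.β lam.len j) (fun j => lam.toAxial j.1))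
    -- THEOREM 8's INPUTS AT THE LAW MEMBERS (replacing the printed member `t8`): constants, the source-indexed gauge predicate with its top-level
    -- clause (1.146), and the five SOURCED sockets — Prop. 5 ∃ (`SP5base`, `SP5`), [4] Thm 3.3 WITH SOURCE (`SH59src`), Prop. 5 ! (`SP5u`), Prop. 3 WITH
    -- SOURCE (`SP3src`) — each demanded ONLY at members `i` with `Ω₀ = ℤᵈ` obeying the four laws (`IdxB8LawsB`), i.e. on `IdxB8SubB θ`
    {cu cP cP3 γ₈ γ' B₈ : ℝ} (hcu : 0 < cu) (hcP : 0 < cP) (hcP3 : 0 < cP3) (hγ₈ : 1 ≤ γ₈) (hγ' : 0 ≤ γ') (hB₀8 : lam.inp.B₀ ≤ B₈)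
    (hγB : 5 * (θ.D : ℝ) * θ.L * lam.inp.B₀ + 2 * (γ' * lam.inp.B₀) ≤ 5 * (θ.D : ℝ) * θ.L * B₈)
    (hB₁eq : lam.B₁ = 5 * (θ.D : ℝ) * θ.L * B₈ * (1 + 11 * (θ.D : ℝ) ^ 2)) (hB₂eq : lam.B₂ = 5 * (θ.D : ℝ) * θ.L * lam.B₀β * (1 + 11 * (θ.D : ℝ) ^ 2))
    (LanF : ZdIdx θ.D θ.L → (Site θ.D → Fin θ.D → θ.𝔸ˣ) → (Site θ.D → θ.𝔸) → ℕ → (Site θ.D → Fin θ.D → θ.𝔸ˣ) → Prop)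
    (hLanF : ∀ i : ZdIdx θ.D θ.L, i.Ω 0 = Set.univ → IdxB8LawsB θ.L i →
      ∀ (U₀ : Site θ.D → Fin θ.D → θ.𝔸ˣ) (f : Site θ.D → θ.𝔸) (W : Site θ.D → Fin θ.D → θ.𝔸ˣ), LanF i U₀ f i.k W ↔ IsLandau146W θ.L i.k i.η (i.Ω 0) (i.Λs i.k) U₀ f W)
    (SP5base : ∀ i : ZdIdx θ.D θ.L, i.Ω 0 = Set.univ → IdxB8LawsB θ.L i → ∀ α₀ α₁ : ℝ, 0 < α₀ → 0 < α₁ → α₀ + α₁ ≤ cP →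
      ∀ U₀ U' : Site θ.D → Fin θ.D → θ.𝔸ˣ, (∀ x κ, U₀ x κ ∈ unitaryUnits θ.𝔸) → (∀ x κ, U' x κ ∈ unitaryUnits θ.𝔸) →
      ∀ φ : Site θ.D → θ.𝔸, (InR138 θ.L i.k i.η (i.Ω 0) (i.Λs i.k) U₀ φ ∧
        msup θ.L i.k i.η (-(2 : ℝ)) (fun j (x : Site θ.D) => x ∈ i.Ω j) φ < γ₈ * (α₀ + α₁)) →
      InAk θ.L i.k i.η α₀ i.Ω U₀ → InAk θ.L i.k i.η α₀ i.Ω (mulCfg U' U₀) → (∀ m, m ≤ i.k → InAx θ.L m (i.Λs m) U₀ (mulCfg U' U₀)) →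
      (∀ j, j ≤ i.k → ∀ (z : Site θ.D) (μ : Fin θ.D), (∀ x, InBox (loK θ.L j z) (bondHiK θ.L j z μ) x → x ∈ i.Ω j) →
        ‖(avgIter θ.L (mulCfg U' U₀) j z μ : θ.𝔸) - (avgIter θ.L U₀ j z μ : θ.𝔸)‖ ≤ α₁) →
      (∀ b ∈ {b : Site θ.D × Fin θ.D | SideTouches (i.Ω 0) b.1 b.2}, ‖((U' b.1 b.2 : θ.𝔸ˣ) : θ.𝔸) - 1‖ ≤ α₁) →
      (∃ (v : Site θ.D → θ.𝔸ˣ) (lm : Site θ.D → θ.𝔸), (∀ x, v x ∈ unitaryUnits θ.𝔸) ∧ (∀ x, x ∉ i.Ω 0 → v x = 1) ∧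
        (∀ j, j ≤ 1 → ∀ b ∈ {b : Site θ.D × Fin θ.D | SideTouches (i.Ω j) b.1 b.2}, (v b.1 : θ.𝔸) = ((gaugeExp lm b.1 : θ.𝔸ˣ) : θ.𝔸) ∧
        (v (b.1 + e b.2) : θ.𝔸) = ((gaugeExp lm (b.1 + e b.2) : θ.𝔸ˣ) : θ.𝔸)) ∧
        (∀ j, j ≤ 1 → ∀ b ∈ {b : Site θ.D × Fin θ.D | SideTouches (i.Ω j) b.1 b.2},
        ‖lm b.1‖ ≤ (8 * lam.inp.B₀' * (5 * (θ.D : ℝ) * θ.L * B₈) * (α₀ + α₁)) ∧ ((θ.L : ℝ) ^ j * i.η) * ‖covDerivFwd i.η U₀ b.2 lm b.1‖ ≤ (8 * lam.inp.B₀' * (5 * (θ.D : ℝ) * θ.L * B₈) * (α₀ + α₁))) ∧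
        LanF i U₀ φ 1 (mgauge U₀ v⁻¹ U') ∧ Restr129 θ.L 1 (i.Λs 1) U₀ ((1 : Site θ.D → θ.𝔸ˣ) * v)))
    (SP5 : ∀ i : ZdIdx θ.D θ.L, i.Ω 0 = Set.univ → IdxB8LawsB θ.L i → ∀ α₀ α₁ : ℝ, 0 < α₀ → 0 < α₁ → α₀ + α₁ ≤ cP →
      ∀ U₀ U' : Site θ.D → Fin θ.D → θ.𝔸ˣ, (∀ x κ, U₀ x κ ∈ unitaryUnits θ.𝔸) → (∀ x κ, U' x κ ∈ unitaryUnits θ.𝔸) →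
      ∀ φ : Site θ.D → θ.𝔸, (InR138 θ.L i.k i.η (i.Ω 0) (i.Λs i.k) U₀ φ ∧
        msup θ.L i.k i.η (-(2 : ℝ)) (fun j (x : Site θ.D) => x ∈ i.Ω j) φ < γ₈ * (α₀ + α₁)) →
      InAk θ.L i.k i.η α₀ i.Ω U₀ → InAk θ.L i.k i.η α₀ i.Ω (mulCfg U' U₀) → (∀ m, m ≤ i.k → InAx θ.L m (i.Λs m) U₀ (mulCfg U' U₀)) →
      (∀ j, j ≤ i.k → ∀ (z : Site θ.D) (μ : Fin θ.D), (∀ x, InBox (loK θ.L j z) (bondHiK θ.L j z μ) x → x ∈ i.Ω j) →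
        ‖(avgIter θ.L (mulCfg U' U₀) j z μ : θ.𝔸) - (avgIter θ.L U₀ j z μ : θ.𝔸)‖ ≤ α₁) →
      (∀ b ∈ {b : Site θ.D × Fin θ.D | SideTouches (i.Ω 0) b.1 b.2}, ‖((U' b.1 b.2 : θ.𝔸ˣ) : θ.𝔸) - 1‖ ≤ α₁) →
      (∀ m, 1 ≤ m → m < i.k → ∀ (u₁ : Site θ.D → θ.𝔸ˣ) (U₁ : Site θ.D → Fin θ.D → θ.𝔸ˣ) (A : Site θ.D → Fin θ.D → θ.𝔸),
        (∀ x, u₁ x ∈ unitaryUnits θ.𝔸) → (∀ x, x ∉ i.Ω 0 → u₁ x = 1) → mgauge U₀ u₁ U₁ = U' → Restr129 θ.L m (i.Λs m) U₀ u₁ →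
        LanF i U₀ φ m U₁ →
        (∀ j, j ≤ m → ∀ b ∈ {b : Site θ.D × Fin θ.D | SideTouches (i.Ω j) b.1 b.2},
        U₁ b.1 b.2 = cfgExp i.η A b.1 b.2 ∧ IsSelfAdjoint (A b.1 b.2) ∧ ‖A b.1 b.2‖ ≤ (5 * (θ.D : ℝ) * θ.L * B₈ * (α₀ + α₁)) * ((θ.L : ℝ) ^ j * i.η)⁻¹) →
        ∃ (v : Site θ.D → θ.𝔸ˣ) (lm : Site θ.D → θ.𝔸), (∀ x, v x ∈ unitaryUnits θ.𝔸) ∧ (∀ x, x ∉ i.Ω 0 → v x = 1) ∧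
        (∀ j, j ≤ m + 1 → ∀ b ∈ {b : Site θ.D × Fin θ.D | SideTouches (i.Ω j) b.1 b.2}, (v b.1 : θ.𝔸) = ((gaugeExp lm b.1 : θ.𝔸ˣ) : θ.𝔸) ∧
        (v (b.1 + e b.2) : θ.𝔸) = ((gaugeExp lm (b.1 + e b.2) : θ.𝔸ˣ) : θ.𝔸)) ∧
        (∀ j, j ≤ m + 1 → ∀ b ∈ {b : Site θ.D × Fin θ.D | SideTouches (i.Ω j) b.1 b.2},
        ‖lm b.1‖ ≤ (8 * lam.inp.B₀' * (5 * (θ.D : ℝ) * θ.L * B₈) * (α₀ + α₁)) ∧ ((θ.L : ℝ) ^ j * i.η) * ‖covDerivFwd i.η U₀ b.2 lm b.1‖ ≤ (8 * lam.inp.B₀' * (5 * (θ.D : ℝ) * θ.L * B₈) * (α₀ + α₁))) ∧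
        LanF i U₀ φ (m + 1) (mgauge U₀ v⁻¹ U₁) ∧ Restr129 θ.L (m + 1) (i.Λs (m + 1)) U₀ (u₁ * v)))
    (SH59src : ∀ i : ZdIdx θ.D θ.L, i.Ω 0 = Set.univ → IdxB8LawsB θ.L i → ∀ α₀ α₁ : ℝ, 0 < α₀ → 0 < α₁ → α₀ + α₁ ≤ cP →
      ∀ U₀ U' : Site θ.D → Fin θ.D → θ.𝔸ˣ, (∀ x κ, U₀ x κ ∈ unitaryUnits θ.𝔸) → (∀ x κ, U' x κ ∈ unitaryUnits θ.𝔸) →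
      ∀ φ : Site θ.D → θ.𝔸, (InR138 θ.L i.k i.η (i.Ω 0) (i.Λs i.k) U₀ φ ∧
        msup θ.L i.k i.η (-(2 : ℝ)) (fun j (x : Site θ.D) => x ∈ i.Ω j) φ < γ₈ * (α₀ + α₁)) →
      InAk θ.L i.k i.η α₀ i.Ω U₀ → InAk θ.L i.k i.η α₀ i.Ω (mulCfg U' U₀) → (∀ m, m ≤ i.k → InAx θ.L m (i.Λs m) U₀ (mulCfg U' U₀)) →
      (∀ j, j ≤ i.k → ∀ (z : Site θ.D) (μ : Fin θ.D), (∀ x, InBox (loK θ.L j z) (bondHiK θ.L j z μ) x → x ∈ i.Ω j) →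
        ‖(avgIter θ.L (mulCfg U' U₀) j z μ : θ.𝔸) - (avgIter θ.L U₀ j z μ : θ.𝔸)‖ ≤ α₁) →
      (∀ b ∈ {b : Site θ.D × Fin θ.D | SideTouches (i.Ω 0) b.1 b.2}, ‖((U' b.1 b.2 : θ.𝔸ˣ) : θ.𝔸) - 1‖ ≤ α₁) →
      (∀ m, 1 ≤ m → m ≤ i.k → ∀ (u : Site θ.D → θ.𝔸ˣ) (W : Site θ.D → Fin θ.D → θ.𝔸ˣ) (A' : Site θ.D → Fin θ.D → θ.𝔸),
        (∀ x, u x ∈ unitaryUnits θ.𝔸) → mgauge U₀ u W = U' → Restr129 θ.L m (i.Λs m) U₀ u → LanF i U₀ φ m W →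
        (∀ y τ, IsSelfAdjoint (A' y τ)) →
        (∀ j, j ≤ m → ∀ y τ, SideTouches (i.Ω j) y τ →
        W y τ = cfgExp i.η A' y τ ∧ ‖A' y τ‖ ≤ (2 * (θ.L * (5 * (θ.D : ℝ) * θ.L * B₈ * (α₀ + α₁))) + 8 * (8 * lam.inp.B₀' * (5 * (θ.D : ℝ) * θ.L * B₈) * (α₀ + α₁))) * ((θ.L : ℝ) ^ j * i.η)⁻¹) →
        (∀ y τ, (∀ j, j ≤ m → ¬ SideTouches (i.Ω j) y τ) → A' y τ = 0) →
        msup θ.L m i.η (-(1 : ℝ)) (fun j (b : Site θ.D × Fin θ.D) => SideTouches (i.Ω j) b.1 b.2) (fun b => A' b.1 b.2)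
        ≤ lam.inp.B₀ * (bondNorm θ.L m i.η (-(3 : ℝ)) i.Ω (fun x μ => Jcur i.η U₀ A' μ x)
        + wsup 1 (fun p : {p : ℕ × (Site θ.D × Fin θ.D) // p.1 ≤ m ∧ p.2 ∈ i.Λb m p.1} =>
        linCovIter θ.L U₀ (iEta i.η A') p.1.1 p.1.2.1 p.1.2.2)) + γ' * lam.inp.B₀ * (α₀ + α₁) ∧
        msup θ.L m i.η (-(2 : ℝ)) (fun j (t : Fin θ.D × Fin θ.D × Site θ.D) => SideTouches (i.Ω j) t.2.2 t.2.1)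
        (fun t => covDerivFwd i.η U₀ t.1 (fun z => A' z t.2.1) t.2.2)
        ≤ lam.inp.B₀ * (bondNorm θ.L m i.η (-(3 : ℝ)) i.Ω (fun x μ => Jcur i.η U₀ A' μ x)
        + wsup 1 (fun p : {p : ℕ × (Site θ.D × Fin θ.D) // p.1 ≤ m ∧ p.2 ∈ i.Λb m p.1} =>
        linCovIter θ.L U₀ (iEta i.η A') p.1.1 p.1.2.1 p.1.2.2)) + γ' * lam.inp.B₀ * (α₀ + α₁)))
    (SP5u : ∀ i : ZdIdx θ.D θ.L, i.Ω 0 = Set.univ → IdxB8LawsB θ.L i → ∀ α₀ α₁ : ℝ, 0 < α₀ → 0 < α₁ → α₀ + α₁ ≤ cP →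
      ∀ U₀ U' : Site θ.D → Fin θ.D → θ.𝔸ˣ, (∀ x κ, U₀ x κ ∈ unitaryUnits θ.𝔸) → (∀ x κ, U' x κ ∈ unitaryUnits θ.𝔸) →
      ∀ φ : Site θ.D → θ.𝔸, (InR138 θ.L i.k i.η (i.Ω 0) (i.Λs i.k) U₀ φ ∧
        msup θ.L i.k i.η (-(2 : ℝ)) (fun j (x : Site θ.D) => x ∈ i.Ω j) φ < γ₈ * (α₀ + α₁)) →
      InAk θ.L i.k i.η α₀ i.Ω U₀ → InAk θ.L i.k i.η α₀ i.Ω (mulCfg U' U₀) → (∀ m, m ≤ i.k → InAx θ.L m (i.Λs m) U₀ (mulCfg U' U₀)) →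
      (∀ j, j ≤ i.k → ∀ (z : Site θ.D) (μ : Fin θ.D), (∀ x, InBox (loK θ.L j z) (bondHiK θ.L j z μ) x → x ∈ i.Ω j) →
        ‖(avgIter θ.L (mulCfg U' U₀) j z μ : θ.𝔸) - (avgIter θ.L U₀ j z μ : θ.𝔸)‖ ≤ α₁) →
      (∀ b ∈ {b : Site θ.D × Fin θ.D | SideTouches (i.Ω 0) b.1 b.2}, ‖((U' b.1 b.2 : θ.𝔸ˣ) : θ.𝔸) - 1‖ ≤ α₁) →
      ∀ u₁ : Site θ.D → θ.𝔸ˣ, (∀ x, u₁ x ∈ unitaryUnits θ.𝔸) → Restr129 θ.L i.k (i.Λs i.k) U₀ u₁ →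
      ∀ (v w : Site θ.D → θ.𝔸ˣ) (lm mu : Site θ.D → θ.𝔸),
      (∀ j, j ≤ i.k → ∀ y ∈ i.Λs i.k j, ∀ x : Site θ.D, InBox (tlo θ.L y j) (thi θ.L y j) x →
        ((gaugeExp lm x : θ.𝔸ˣ) : θ.𝔸) = ((v x : θ.𝔸ˣ) : θ.𝔸) ∧ IsSelfAdjoint (lm x) ∧ ‖lm x‖ < cu ∧
          ∀ κ : Fin θ.D, InBox (tlo θ.L y j) (thi θ.L y j) (x + e κ) → ((θ.L : ℝ) ^ j * i.η) * ‖covDerivFwd i.η U₀ κ lm x‖ < cu) →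
      (∀ j, j ≤ i.k → ∀ y ∈ i.Λs i.k j, ∀ x : Site θ.D, InBox (tlo θ.L y j) (thi θ.L y j) x →
        ((gaugeExp mu x : θ.𝔸ˣ) : θ.𝔸) = ((w x : θ.𝔸ˣ) : θ.𝔸) ∧ IsSelfAdjoint (mu x) ∧ ‖mu x‖ < cu ∧
          ∀ κ : Fin θ.D, InBox (tlo θ.L y j) (thi θ.L y j) (x + e κ) → ((θ.L : ℝ) ^ j * i.η) * ‖covDerivFwd i.η U₀ κ mu x‖ < cu) →
      LanF i U₀ φ i.k (mgauge U₀ v⁻¹ (mgauge U₀ u₁⁻¹ U')) → Restr129 θ.L i.k (i.Λs i.k) U₀ (u₁ * v) →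
      LanF i U₀ φ i.k (mgauge U₀ w⁻¹ (mgauge U₀ u₁⁻¹ U')) → Restr129 θ.L i.k (i.Λs i.k) U₀ (u₁ * w) →
      ∀ j, j ≤ i.k → ∀ y ∈ i.Λs i.k j, ∀ x : Site θ.D, InBox (tlo θ.L y j) (thi θ.L y j) x → v x = w x)
    (SP3src : ∀ i : ZdIdx θ.D θ.L, i.Ω 0 = Set.univ → IdxB8LawsB θ.L i → ∀ α₀ α₁ α₂ : ℝ, 0 < α₀ → α₀ ≤ cP3 → 0 < α₁ → α₁ ≤ cP3 → 0 < α₂ → α₂ ≤ cP3 →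
      2 * α₂ ^ 2 + 20 * θ.D * α₀ * α₂ + 2 * (2097152 * ((θ.D : ℝ) + 1) ^ 2) * α₂ ^ 2 ≤ α₀ + α₁ →
      ∀ (U₀ : (zdGF3 θ.𝔸 θ.L lam.β lam.len i).Cfg) (P' : (zdGF3 θ.𝔸 θ.L lam.β lam.len i).Pert) (f : Site θ.D → θ.𝔸),
        (zdGF3 θ.𝔸 θ.L lam.β lam.len i).InR U₀ f → (zdGF3 θ.𝔸 θ.L lam.β lam.len i).fNorm f < γ₈ * (α₀ + α₁) → (zdGF3 θ.𝔸 θ.L lam.β lam.len i).fGrad U₀ f < γ₈ * (α₀ + α₁) →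
        (zdGF3 θ.𝔸 θ.L lam.β lam.len i).InA α₀ U₀ → (zdGF3 θ.𝔸 θ.L lam.β lam.len i).InAPair α₀ U₀ P' → (zdGF3 θ.𝔸 θ.L lam.β lam.len i).C162 1 α₂ U₀ P' →
        (zdGF3 θ.𝔸 θ.L lam.β lam.len i).LandauF U₀ f P' → (zdGF3 θ.𝔸 θ.L lam.β lam.len i).C137 α₁ U₀ P' →
        (zdGF3 θ.𝔸 θ.L lam.β lam.len i).C136 (5 * θ.D * θ.L * B₈) (5 * θ.D * θ.L * lam.B₀β) (α₀ + α₁) U₀ P' ∧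
          (zdGF3 θ.𝔸 θ.L lam.β lam.len i).C139 (5 * θ.D * θ.L * B₈) (α₀ + α₁) U₀ P') :
    ∃ c₁ : ℝ, 0 < c₁ ∧
      B8LeafRS θ.D (θ.L : ℝ) lam.C₂ lam.B₁' lam.inp.B₀' lam.B₁ lam.B₂ c₁ lam.inp lam.B₀β (blockPairNA θ.D θ.L θ.𝔸)
        (fun j : IdxB8SubB θ => famB8OfRecordSubB θ lam.β lam.len j) (fun a : J => zdLan θ.L lam.B₁ (ι a))
        (fun j : IdxB8SubB θ => cubB8OfRecord θ j.1) (fun j => lam.toAxial j.1) := by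
  -- constants: `0 < B₀ ≤ B₈`, `2 ≤ 5dLB₀ ≤ 5dLB₈ ≤ λ.B₁`
  have hB₀ : 0 < lam.inp.B₀ := lam.inp.B₀_pos
  have hB₈ : 0 < B₈ := lt_of_lt_of_le hB₀ hB₀8
  have h5 : 0 ≤ 5 * (θ.D : ℝ) * θ.L := by positivity
  have hB8' : 2 ≤ 5 * (θ.D : ℝ) * θ.L * B₈ := hB.trans (mul_le_mul_of_nonneg_left hB₀8 h5)
  have hD1 : (1 : ℝ) ≤ 1 + 11 * (θ.D : ℝ) ^ 2 := le_add_of_nonneg_right (by positivity)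
  have hB₁ : 5 * (θ.D : ℝ) * θ.L * lam.inp.B₀ ≤ lam.B₁ := by
    rw [hB₁eq]
    calc 5 * (θ.D : ℝ) * θ.L * lam.inp.B₀ ≤ 5 * (θ.D : ℝ) * θ.L * B₈ := mul_le_mul_of_nonneg_left hB₀8 h5
      _ = 5 * (θ.D : ℝ) * θ.L * B₈ * 1 := (mul_one _).symm
      _ ≤ 5 * (θ.D : ℝ) * θ.L * B₈ * (1 + 11 * (θ.D : ℝ) ^ 2) := mul_le_mul_of_nonneg_left hD1 (by positivity)
  have hB₁2 : 2 ≤ lam.B₁ := hB.trans hB₁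
  -- THEOREM 8 (surviving) at the law members from the sourced sockets: `thm8SurvivingAt_zd3_map_lan` at `ι := fun j : IdxB8SubB θ => j.1.1`, then `γ ↦ 1`
  have t8γ := thm8SurvivingAt_zd3_map_lan (𝔸 := θ.𝔸) (β := lam.β) (len := lam.len) hD θ.two_le_L hB₀ lam.inp.B₀'_pos hcu hcP hcP3
    (lt_of_lt_of_le one_pos hγ₈) hγ' hB₈ hB₀8 hB8' hγB (fun j : IdxB8SubB θ => j.1.1) (fun j => j.1.2) (fun j => LanF j.1.1)
    (fun j => hLanF j.1.1 j.1.2 j.2) (fun j => SP5base j.1.1 j.1.2 j.2) (fun j => SP5 j.1.1 j.1.2 j.2) (fun j => SH59src j.1.1 j.1.2 j.2)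
    (fun j => SP5u j.1.1 j.1.2 j.2) (fun j => SP3src j.1.1 j.1.2 j.2)
  have t8 : B8Thm8Surviving.Thm8SurvivingAt 1 lam.B₁ lam.B₂ (fun j : IdxB8SubB θ => famB8OfRecordSubB θ lam.β lam.len j) := by
    rw [hB₁eq, hB₂eq]
    exact B8Thm8Surviving.thm8SurvivingAt_anti _ hγ₈ t8γ
  -- p482401 §2 by name
  exact exists_c₁_b8LeafRS_subB_cut_zdLan_of_knit_lettersRDUB lam hD hB₁' hB₁ hB hB₀β hC₂ hcB9 hB₀'H hB₂' hBG hBR hcL hfree hB₁2 hfree2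
    SLet SLetUB SB9all SLetC SB9C ι hΩ0L hΩL htowerL SLetL SLetLU p7 t8

end KnitT8

end Summit.QuantumFields.YangMills.BalabanUVNodes.N05SubBKnitZdLanT8

end
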